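import Summits.Ventures.PercRepro.ProfilePointedMovesBounds

/-!
# PercRepro — THE BLOCKED-MOVE FORM OF (A1κ), LEVEL BY LEVEL   (p10, gen 16; `proofs/P10-AVFULL.md` §24(c), (j))

For a finite matroid `M` on `N = #E`, a point `p` and the levels `𝒦_k` of the captured family (`κ_k = capCount M k p`),
the edge identity of ProfilePointedMoves reads, per level, `(N − 1 − k)·κ_k = e_k + BU_k` and `(k + 1)·κ_{k+1} = e_k + BD_{k+1}`,
where `e_k` is the number of edges between the levels, `BU_k = Σ_{𝒦_k} #upBlocked` and `BD_{k+1} = Σ_{𝒦_{k+1}} #downBlocked`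
(`card_mul_capCount_eq_up`, `succ_mul_capCount_eq_down`).  Hence THE SHARPEST POINTED CONJECTURE (A1κ) of gen 15,
`(N − k − 1)·κ_k ≤ k·κ_{k+1}`, is at every level EQUIVALENT to the shadow-type inequality between the blocked moves of
consecutive levels, `BU_k + κ_{k+1} ≤ BD_{k+1}` (`pointedRowCap_level_iff_blocked`): the blocked up-moves of level `k`
plus one token per set of level `k + 1` are dominated by the blocked down-moves of level `k + 1`.  Summed over all
levels this is the blocked-move form of (C1′).  Nothing here asserts (A1κ), (C1′) or (★).
-/

open scoped Matroid

namespace PercRepro.Cogirth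

open Finset ThmH Skew

variable {α : Type} [DecidableEq α] {M : Matroid α} [M.Finite]

/-- `(N − 1 − k)·κ_k = Σ_{𝒦_k} #upMoves + Σ_{𝒦_k} #upBlocked`. -/
theorem card_mul_capCount_eq_up {p : α} (hp : p ∈ gr M) (k : ℕ) :
    ((gr M).card - 1 - k) * capCount M k p =
      ∑ X ∈ (capSets M p).filter (fun X => X.card = k), (upMoves M p X).card +
        ∑ X ∈ (capSets M p).filter (fun X => X.card = k), (upBlocked M p X).card := by
  rw [← sum_add_distrib, ← card_capSets_filter, mul_comm, ← smul_eq_mul, ← sum_const]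
  apply sum_congr rfl
  intro X hX
  rw [mem_filter] at hX
  have h1 := card_upMoves_add_card_upBlocked (M := M) p X
  have h2 := card_pSide_add hp hX.1
  rw [h1]
  omega

/-- `(k + 1)·κ_{k+1} = Σ_{𝒦_{k+1}} #downMoves + Σ_{𝒦_{k+1}} #downBlocked`. -/
theorem succ_mul_capCount_eq_down (p : α) (k : ℕ) :
    (k + 1) * capCount M (k + 1) p =
      ∑ X ∈ (capSets M p).filter (fun X => X.card = k + 1), (downMoves M p X).card +
        ∑ X ∈ (capSets M p).filter (fun X => X.card = k + 1), (downBlocked M p X).card := by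
  rw [← sum_add_distrib, ← card_capSets_filter, mul_comm, ← smul_eq_mul, ← sum_const]
  apply sum_congr rfl
  intro X hX
  rw [mem_filter] at hX
  rw [card_downMoves_add_card_downBlocked, hX.2]

/-- **THE BLOCKED-MOVE FORM OF (A1κ) AT LEVEL `k`**: `(N − k − 1)·κ_k ≤ k·κ_{k+1}` iff
`Σ_{𝒦_k} #upBlocked + κ_{k+1} ≤ Σ_{𝒦_{k+1}} #downBlocked`. -/
theorem pointedRowCap_level_iff_blocked {p : α} (hp : p ∈ gr M) (k : ℕ) :
    ((gr M).card - k - 1) * capCount M k p ≤ k * capCount M (k + 1) p ↔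
      ∑ X ∈ (capSets M p).filter (fun X => X.card = k), (upBlocked M p X).card + capCount M (k + 1) p ≤
        ∑ X ∈ (capSets M p).filter (fun X => X.card = k + 1), (downBlocked M p X).card := by
  have hu := card_mul_capCount_eq_up (M := M) hp k
  have hd := succ_mul_capCount_eq_down (M := M) p k
  have he := sum_card_upMoves_eq_sum_card_downMoves_level (M := M) p k
  have hk : (gr M).card - k - 1 = (gr M).card - 1 - k := by omega
  rw [hk]
  constructor
  · intro h
    have : (k + 1) * capCount M (k + 1) p = k * capCount M (k + 1) p + capCount M (k + 1) p := by ring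
    omega
  · intro h
    have : (k + 1) * capCount M (k + 1) p = k * capCount M (k + 1) p + capCount M (k + 1) p := by ring
    omega

end PercRepro.Cogirth
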